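import Summits.QuantumFields.YangMills.Theses.SqueezedSkewness
import Summits.QuantumFields.YangMills.Theses.ThermalDescent

/-!
# Birth skeleton for `SqueezedSkewness.ElectricSeamH` (rev 11 item stmt-QuantumFields-23203; planner ym-idea-6 g10, LINE α)

Re-key of `Lines/electric_seam_birth.lean` (item ElectricSeam 25582, now aside) to the HYPERCUBE-conditioned seam ceiling
`ElectricSeamH` that the rev-11 `closes` consumes.  Stubs: `stub_seamFromMoments` = `ThermalDescent.SeamFromMoments`
(item stmt-QuantumFields-27002) BY NAME (M, lattice analysis from the sixth-moment ceilings; valid at PHYSICAL separation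
because the femto restriction of `MomentBounds6` is on the collar radius `R ≤ ℓ₄/a`, not on the separation), and
`stub_floorUnitMomentsH` = `ThermalDescent.FloorUnitMoments` (27003) with its conditioning floor moved from the
period-doubled cylinders to the hypercube `(2L+1)⁴` (the spine's `DlrCollarTransfer.MomentBounds6 G r a` at every unit
carrying hypercube reflection floors of a slab test function; XL-by-dependency = the W2 currency).  Composition =
the two-line plumbing of `Theorems/ThermalDescentElectricSeamGlue.lean`.  No summit / NT statement is proved here. -/

set_option autoImplicit false

namespace Summit.QuantumFields.YangMills.Cruxes.NT.ElectricSeamHBirth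

open Summit.QuantumFields.YangMills.Theses.SqueezedSkewness

namespace __Registered

/-- Statement of `stub_seamFromMoments` = `ThermalDescent.SeamFromMoments` (item stmt-QuantumFields-27002), by name. -/
abbrev stub_seamFromMoments : Prop :=
  Summit.QuantumFields.YangMills.Theses.ThermalDescent.SeamFromMoments

/-- Statement of `stub_floorUnitMomentsH`: `MomentBounds6 G r a` at every unit carrying HYPERCUBE reflection floors of a slab
test function (FloorUnitMoments 27003 with `2^k(2L+1)` ↦ `2L+1` and the `k₀/k` quantifiers deleted). -/
abbrev stub_floorUnitMomentsH : Prop :=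
  ∀ (G : Type) [Group G] [TopologicalSpace G] [IsTopologicalGroup G] [CompactSpace G], Literature.MathematicalPhysics.QuantumFieldTheory.IsCompactSimpleLieGroup G → letI : MeasurableSpace G := borel G; haveI : BorelSpace G := ⟨rfl⟩; ∀ (r : Literature.MathematicalPhysics.QuantumFieldTheory.LatticeRep G) (a : ℝ → ℝ), (∀ β, 0 < a β) → Filter.Tendsto a Filter.atTop (nhds 0) → let St : ℕ → ℕ → Type := fun S T => Literature.MathematicalPhysics.QuantumFieldTheory.FinTorusSite S S S T; let Cfg : ℕ → ℕ → Type := fun S T => Literature.MathematicalPhysics.QuantumFieldTheory.FinTorusSite S S S T × Fin 4 → G; let cc : (n : ℕ) → Fin n → ℤ := fun n i => if 2 * i.val < n then (i.val : ℤ) else (i.val : ℤ) - n; let posE : (S T : ℕ) → St S T → EuclideanSpace ℝ (Fin 4) := fun S T x => Literature.MathematicalPhysics.QuantumLattice.siteToE (d := 4) ![cc T x.2.2.2, cc S x.1, cc S x.2.1, cc S x.2.2.1]; let P : (S T : ℕ) → St S T → Fin 4 → Fin 4 → Cfg S T → ℝ := fun _ _ x i j U => (r.ρ (Literature.MathematicalPhysics.QuantumFieldTheory.finTorusPlaquette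 U x i j)).trace.re; let A : (S T : ℕ) → St S T → Cfg S T → ℝ := fun S T x U => ∑ q : {q : Fin 4 × Fin 4 // q.1 < q.2}, P S T x q.1.1 q.1.2 U; let w : ℝ → (S T : ℕ) → Cfg S T → ℝ := fun β S T U => Real.exp (-β * ∑ x : St S T, ∑ q : {q : Fin 4 × Fin 4 // q.1 < q.2}, ((r.N : ℝ) - P S T x q.1.1 q.1.2 U)); let E : ℝ → (S T : ℕ) → (Cfg S T → ℝ) → ℝ := fun β S T F => (∫ U : Literature.MathematicalPhysics.QuantumFieldTheory.FinTorusSite S S S T × Fin 4 → G, F U * w β S T U ∂MeasureTheory.Measure.pi (fun _ => Literature.MathematicalPhysics.QuantumFieldTheory.haarProbability G)) / Literature.MathematicalPhysics.QuantumFieldTheory.wilsonFinTorusPartition r.ρ β S S S T; let Cov : ℝ → (S T : ℕ) → (Cfg S T → ℝ) → (Cfg S T → ℝ) → ℝ := fun β S T F F' => E β S T (fun U => F U * F' U) - E β S T F * E β S T F'; let refl : (S T : ℕ) → Cfg S T → Cfg S T := fun _ T U e => if e.2 = Fin.last 3 then (U ((e.1.1, e.1.2.1, e.1.2.2.1, Fin.rev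 e.1.2.2.2), Fin.last 3))⁻¹ else U ((e.1.1, e.1.2.1, e.1.2.2.1, ⟨(T - e.1.2.2.2.val) % T, Nat.mod_lt _ e.1.2.2.2.pos⟩), e.2); let B : (S T : ℕ) → ℝ → SchwartzMap (EuclideanSpace ℝ (Fin 4)) ℝ → Cfg S T → ℝ := fun S T s f U => ∑ x : St S T, f (s • posE S T x) * A S T x U; let Qrp : ℝ → (S T : ℕ) → ℝ → SchwartzMap (EuclideanSpace ℝ (Fin 4)) ℝ → ℝ := fun β S T s f => Cov β S T (fun U => B S T s f (refl S T U)) (B S T s f); ∀ (v : SchwartzMap (EuclideanSpace ℝ (Fin 4)) ℝ) (δ₁ δ₂ : ℝ), 0 < δ₁ → tsupport v ⊆ {y : EuclideanSpace ℝ (Fin 4) | δ₁ < y 0 ∧ y 0 < δ₂} → (∃ (ε β₅ Λ₅ : ℝ), 0 < ε ∧ ∀ β : ℝ, β₅ ≤ β → ∀ L : ℕ, Λ₅ ≤ a β * L → ε ≤ Qrp β (2 * L + 1) (2 * L + 1) (a β) v) → Summit.QuantumFields.YangMills.Cruxes.OSLegsFromFemtoAndGap.DlrCollarTransfer.MomentBounds6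 G r a

end __Registered

/-! ## The two registered stubs — the ONLY `sorry`s of this file -/

/-- stub (M): seam from moments (= item 27002).  OPEN, provable now. -/
theorem stub_seamFromMoments : __Registered.stub_seamFromMoments := by
  sorry

/-- stub (XL-by-dependency): sixth-moment ceilings at the hypercube-floor unit.  OPEN. -/
theorem stub_floorUnitMomentsH : __Registered.stub_floorUnitMomentsH := by
  sorry

/-! ## Composition (no `sorry` below): the crux BY NAME -/

/-- **ElectricSeamH_of** : `SeamFromMoments → FloorUnitMomentsH → ElectricSeamH`. -/
theorem ElectricSeamH_of (h1 : __Registered.stub_seamFromMoments)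
    (h2 : __Registered.stub_floorUnitMomentsH) :
    ElectricSeamH := by
  intro G _ _ _ _ hG r a ha ha0 St Cfg cc posE P A Ael w E Cov refl B Qrp D Drp v δ₁ δ₂ hδ hsupp hfl η hη
  exact h1 G hG r a ha ha0 (h2 G hG r a ha ha0 v δ₁ δ₂ hδ hsupp hfl) v δ₁ δ₂ hδ hsupp η hη

end Summit.QuantumFields.YangMills.Cruxes.NT.ElectricSeamHBirth
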